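import Mathlib.Algebra.Field.ULift
import Mathlib.Algebra.CharP.Basic
import Mathlib.GroupTheory.Index
import Mathlib.LinearAlgebra.Matrix.GeneralLinearGroup.Defs
import Literature.NumberTheory.GaloisRepresentations.AdequacyDegreeP
import Literature.RepresentationTheory.Semisimple.BurnsideMatrixSpan
import HarnessLib

/-!
# Crux `MuOrdinaryFamilyRT` (stmt-Langlands-13757), line `thorne-minimal-lift`:
# extended adequacy is invariant under an isomorphism of the coefficient field, and the
# Guralnick–Herzig–Tiep named fact at universe `0`

Helper file of the registered helper `rbarExtendedAdequate_of` (wave 2 of the line; companion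
`…ThorneRbarAdequate.lean`).  The tree's named fact
`Literature.NumberTheory.GaloisRepresentations.ght2017_adequate_or_index_p_or_psl29` (GHT, JEMS 19
(2017) Thm 1.7, disjunction form) is universe-polymorphic in the coefficient field `k : Type u` and
the group `G : Type v`; taken as a HYPOTHESIS of a theorem it is generalised to arbitrary levels
`u, v`, while the residual heart `r̄_f^B : Γ_K → GL₃(𝔽₃)` of the crux lives at level `0`.  This file
bridges the gap honestly:

* § 1 `isExtendedAdequate_map` — for a ring isomorphism `e : k ≃+* k'` and `H ≤ GL_n(k)`,
  `Subgroup.IsExtendedAdequate H → Subgroup.IsExtendedAdequate (GL_n(e) H)`: the three clauses of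
  GHT §1 / Thorne 2017 Def. 2.20 (`Hom(H, k) = 0`, `H¹(H, ad/Z) = 0`, `M_n(k)` spanned by the
  semisimple elements) are transported along `GL_n(e) : H ≅ GL_n(e) H` and the `e`-semilinear
  bijection `M_n(k) → M_n(k')` (which maps scalars to scalars, commutes with conjugation and
  preserves orders of elements);
* § 2 `ght_univ_zero` (registered; explicit-universe form `ght_univ_zero_aux`) — from the fact at
  levels `(u, v)`, its instance for `k G : Type`: apply it to
  `ULift k`, `ULift G` (absolute irreducibility passes to the lift by Burnside's spanning criterion
  `span_eq_top_iff_forall_isIrreducible`, whose "spanning ⇒ irreducible" half is level-free), come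
  back with § 1 for alternative (a), pull the abelian normal subgroup back along `G ≃* ULift G` for
  (b), and record (c) (`PSL₂(9) ≅ A₆` as projective image) only through the inequality
  `#A₆ ≤ #G` it implies — all a user excluding (c) by counting needs.
-/

-- `Summit.Langlands.Langlands.…` (summit = sub-problem name, D-0017 layout) trips `dupNamespace` on every decl.
set_option linter.dupNamespace false

namespace Summit.Langlands.Langlands.Cruxes.MuOrdinaryFamilyRT.ThorneMinimalLift

open Literature.NumberTheory.GaloisRepresentations Literature.RepresentationTheory.Semisimple

noncomputable section

universe u v

/-! ## 1. Transport of extended adequacy along an isomorphism of the coefficient field -/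

section Transport

variable {k : Type*} {k' : Type*} [Field k] [Field k'] {n : ℕ} (e : k ≃+* k')

/-- `GL_n(e)` is injective for a ring isomorphism `e`. -/
theorem glMap_injective :
    Function.Injective (Matrix.GeneralLinearGroup.map (n := Fin n) e.toRingHom) := by
  intro a b h
  apply Units.ext
  exact Matrix.map_injective e.injective
    (congrArg (fun g : GL (Fin n) k' => (g : Matrix (Fin n) (Fin n) k')) h)

/-- The matrix of `GL_n(e) g` is `e` applied entrywise. -/
theorem coe_glMap (g : GL (Fin n) k) :
    ((Matrix.GeneralLinearGroup.map e.toRingHom g : GL (Fin n) k') : Matrix (Fin n) (Fin n) k') =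
      (g : Matrix (Fin n) (Fin n) k).map e := rfl

/-- The matrix of `(GL_n(e) g)⁻¹` is `e` applied entrywise to `g⁻¹`. -/
theorem coe_glMap_inv (g : GL (Fin n) k) :
    (((Matrix.GeneralLinearGroup.map e.toRingHom g)⁻¹ : GL (Fin n) k') : Matrix (Fin n) (Fin n) k') =
      ((g⁻¹ : GL (Fin n) k) : Matrix (Fin n) (Fin n) k).map e := by
  rw [← map_inv]; rfl

/-- `GL_n(e⁻¹) ∘ GL_n(e) = id`. -/
theorem glMap_symm_glMap (g : GL (Fin n) k) :
    Matrix.GeneralLinearGroup.map e.symm.toRingHom (Matrix.GeneralLinearGroup.map e.toRingHom g) = g := by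
  apply Units.ext
  change ((g : Matrix (Fin n) (Fin n) k).map e).map e.symm = g
  rw [Matrix.map_map, show (e.symm : k' → k) ∘ (e : k → k') = id from funext e.symm_apply_apply,
    Matrix.map_id]

/-- `GL_n(e) ∘ GL_n(e⁻¹) = id`. -/
theorem glMap_glMap_symm (g : GL (Fin n) k') :
    Matrix.GeneralLinearGroup.map e.toRingHom (Matrix.GeneralLinearGroup.map e.symm.toRingHom g) = g := by
  apply Units.ext
  change ((g : Matrix (Fin n) (Fin n) k').map e.symm).map e = g
  rw [Matrix.map_map, show (e : k → k') ∘ (e.symm : k' → k) = id from funext e.apply_symm_apply,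
    Matrix.map_id]

include e in
/-- The characteristic is invariant under a ring isomorphism. -/
theorem ringChar_eq_of_ringEquiv : ringChar k' = ringChar k := by
  haveI : CharP k' (ringChar k) := charP_of_injective_ringHom (f := e.toRingHom) e.injective (ringChar k)
  exact ringChar.eq k' (ringChar k)

/-- Entrywise, `(c • M).map e = e c • M.map e`. -/
theorem map_smul_ringEquiv (c : k) (M : Matrix (Fin n) (Fin n) k) : (c • M).map e = e c • M.map e := by
  ext i j
  simp

/-- **The `e`-semilinear map `ad/Z → ad'/Z'`** induced by `M ↦ e(M)` (which maps scalars to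
scalars), recorded through its defining property on classes of matrices (as an additive map; no
definition is introduced). -/
theorem exists_adQuot :
    ∃ Ψ : (Matrix (Fin n) (Fin n) k ⧸ scalarMatrices (Fin n) k) →+
        (Matrix (Fin n) (Fin n) k' ⧸ scalarMatrices (Fin n) k'),
      ∀ M, Ψ (Submodule.Quotient.mk M) = Submodule.Quotient.mk (M.map e) := by
  let L : Matrix (Fin n) (Fin n) k →ₛₗ[e.toRingHom] Matrix (Fin n) (Fin n) k' :=
    { toFun := fun M => M.map e
      map_add' := fun M N => Matrix.map_add e (map_add e) M N
      map_smul' := fun c M => by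
        change (c • M).map e = e c • M.map e
        exact map_smul_ringEquiv e c M }
  have hL : scalarMatrices (Fin n) k ≤ (scalarMatrices (Fin n) k').comap L := by
    intro M hM
    obtain ⟨c, rfl⟩ := (mem_scalarMatrices_iff M).1 hM
    rw [Submodule.mem_comap]
    change (c • (1 : Matrix (Fin n) (Fin n) k)).map e ∈ scalarMatrices (Fin n) k'
    rw [map_smul_ringEquiv, Matrix.map_one e (map_zero e) (map_one e)]
    exact smul_one_mem_scalarMatrices k' (e c)
  exact ⟨(Submodule.mapQ _ _ L hL).toAddMonoidHom, fun M => rfl⟩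

variable {e}

/-- `Ψ_{e⁻¹} ∘ Ψ_e = id` for maps `Ψ` as in `exists_adQuot`. -/
theorem adQuot_symm_adQuot
    {Ψ : (Matrix (Fin n) (Fin n) k ⧸ scalarMatrices (Fin n) k) →+ (Matrix (Fin n) (Fin n) k' ⧸ scalarMatrices (Fin n) k')}
    (hΨ : ∀ M, Ψ (Submodule.Quotient.mk M) = Submodule.Quotient.mk (M.map e))
    {Ψ' : (Matrix (Fin n) (Fin n) k' ⧸ scalarMatrices (Fin n) k') →+ (Matrix (Fin n) (Fin n) k ⧸ scalarMatrices (Fin n) k)}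
    (hΨ' : ∀ M, Ψ' (Submodule.Quotient.mk M) = Submodule.Quotient.mk (M.map e.symm))
    (x : Matrix (Fin n) (Fin n) k ⧸ scalarMatrices (Fin n) k) : Ψ' (Ψ x) = x := by
  obtain ⟨M, rfl⟩ := Submodule.Quotient.mk_surjective _ x
  rw [hΨ, hΨ', Matrix.map_map,
    show (e.symm : k' → k) ∘ (e : k → k') = id from funext e.symm_apply_apply, Matrix.map_id]

/-- `Ψ_e` intertwines the adjoint actions of `g` and `GL_n(e) g` on `ad/Z`. -/
theorem adQuot_adModScalar
    {Ψ : (Matrix (Fin n) (Fin n) k ⧸ scalarMatrices (Fin n) k) →+ (Matrix (Fin n) (Fin n) k' ⧸ scalarMatrices (Fin n) k')}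
    (hΨ : ∀ M, Ψ (Submodule.Quotient.mk M) = Submodule.Quotient.mk (M.map e))
    (g : GL (Fin n) k) (x : Matrix (Fin n) (Fin n) k ⧸ scalarMatrices (Fin n) k) :
    Ψ (adModScalar (Fin n) k g x) =
      adModScalar (Fin n) k' (Matrix.GeneralLinearGroup.map e.toRingHom g) (Ψ x) := by
  obtain ⟨M, rfl⟩ := Submodule.Quotient.mk_surjective _ x
  rw [adModScalar_apply_mk, hΨ, hΨ, adModScalar_apply_mk, coe_glMap_inv, coe_glMap,
    Matrix.map_mul, Matrix.map_mul]

variable (e)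

variable {H : Subgroup (GL (Fin n) k)}

/-- Clause (i) transported: `Hom(GL_n(e) H, k') = 0`. -/
theorem addMonoidHom_map_eq_zero (hH : Subgroup.IsExtendedAdequate H)
    (F : Additive ↥(H.map (Matrix.GeneralLinearGroup.map e.toRingHom)) →+ k') : F = 0 := by
  set φ := H.equivMapOfInjective _ (glMap_injective (n := n) e) with hφ
  let F₀ : Additive H →+ k :=
    e.symm.toRingHom.toAddMonoidHom.comp (F.comp (MonoidHom.toAdditive φ.toMonoidHom))
  have h0 := hH.addMonoidHom_eq_zero F₀
  refine AddMonoidHom.ext fun x => ?_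
  have hx := DFunLike.congr_fun h0 (Additive.ofMul (φ.symm (Additive.toMul x)))
  change e.symm (F (Additive.ofMul (φ (φ.symm (Additive.toMul x))))) = 0 at hx
  rw [MulEquiv.apply_symm_apply, ofMul_toMul] at hx
  rw [AddMonoidHom.zero_apply]
  simpa using congrArg e hx

/-- The semisimple elements of `H` go to semisimple elements of `GL_n(e) H`, hence the image of the
semisimple span of `H` lies in that of `GL_n(e) H`. -/
theorem map_mem_semisimpleSpan {M : Matrix (Fin n) (Fin n) k} (hM : M ∈ Subgroup.semisimpleSpan H) :
    M.map e ∈ Subgroup.semisimpleSpan (H.map (Matrix.GeneralLinearGroup.map e.toRingHom)) := by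
  have hchar : ringChar k' = ringChar k := ringChar_eq_of_ringEquiv e
  rw [Subgroup.semisimpleSpan_def] at hM ⊢
  induction hM using Submodule.span_induction with
  | mem x hx =>
    obtain ⟨h, hh, rfl⟩ := hx
    refine Submodule.subset_span ⟨⟨Matrix.GeneralLinearGroup.map e.toRingHom h,
      Subgroup.mem_map_of_mem _ h.2⟩, ?_, rfl⟩
    rw [hchar]
    change (orderOf (Matrix.GeneralLinearGroup.map e.toRingHom (h : GL (Fin n) k))).Coprime (ringChar k)
    rwa [orderOf_injective _ (glMap_injective e)]
  | zero => rw [Matrix.map_zero e (map_zero e)]; exact Submodule.zero_mem _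
  | add x y _ _ hx hy => rw [Matrix.map_add e (map_add e) x y]; exact Submodule.add_mem _ hx hy
  | smul c x _ hx =>
    rw [map_smul_ringEquiv]
    exact Submodule.smul_mem _ _ hx

/-- Clause (iii) transported: `M_n(k')` is spanned by the semisimple elements of `GL_n(e) H`. -/
theorem semisimpleSpan_map_eq_top (hH : Subgroup.IsExtendedAdequate H) :
    Subgroup.semisimpleSpan (H.map (Matrix.GeneralLinearGroup.map e.toRingHom)) = ⊤ := by
  rw [eq_top_iff]
  rintro M -
  have h := map_mem_semisimpleSpan e (hH.mem_semisimpleSpan (M.map e.symm))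
  rwa [Matrix.map_map, show (e : k → k') ∘ (e.symm : k' → k) = id from funext e.apply_symm_apply,
    Matrix.map_id] at h

/-- Clause (ii) transported: `H¹(GL_n(e) H, ad'/Z') = 0` (a `1`-cocycle of `GL_n(e) H` pulls back
along `H ≅ GL_n(e) H` and `Ψ_{e⁻¹}` to a `1`-cocycle of `H`, which is a coboundary). -/
theorem cocycles₁_le_coboundaries₁_map (hH : Subgroup.IsExtendedAdequate H) :
    groupCohomology.cocycles₁
        (Rep.of (Subgroup.adModScalarRep (H.map (Matrix.GeneralLinearGroup.map e.toRingHom)))) ≤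
      groupCohomology.coboundaries₁
        (Rep.of (Subgroup.adModScalarRep (H.map (Matrix.GeneralLinearGroup.map e.toRingHom)))) := by
  obtain ⟨Ψ, hΨ⟩ := exists_adQuot (n := n) e
  obtain ⟨Ψ', hΨ'⟩ := exists_adQuot (n := n) e.symm
  refine (cocycles₁_le_coboundaries₁_iff_forall _).2 fun c' hc' => ?_
  set φ := H.equivMapOfInjective _ (glMap_injective (n := n) e) with hφdef
  have hφ : ∀ h : H, ((φ h : ↥(H.map (Matrix.GeneralLinearGroup.map e.toRingHom))) : GL (Fin n) k') =
      Matrix.GeneralLinearGroup.map e.toRingHom (h : GL (Fin n) k) :=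
    fun h => Subgroup.coe_equivMapOfInjective_apply H _ (glMap_injective e) h
  let c : H → Matrix (Fin n) (Fin n) k ⧸ scalarMatrices (Fin n) k := fun h => Ψ' (c' (φ h))
  have hc : ∀ g h : H, c (g * h) = Subgroup.adModScalarRep H g (c h) + c g := by
    intro g h
    change Ψ' (c' (φ (g * h))) = adModScalar (Fin n) k (g : GL (Fin n) k) (Ψ' (c' (φ h))) + Ψ' (c' (φ g))
    rw [map_mul, hc', map_add]
    congr 1
    change Ψ' (adModScalar (Fin n) k'
      ((φ g : ↥(H.map (Matrix.GeneralLinearGroup.map e.toRingHom))) : GL (Fin n) k') (c' (φ h))) = _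
    rw [adQuot_adModScalar hΨ', hφ, glMap_symm_glMap]
  obtain ⟨m, hm⟩ := hH.exists_eq_sub_of_cocycle c hc
  refine ⟨Ψ m, fun g' => ?_⟩
  have hg' : φ (φ.symm g') = g' := φ.apply_symm_apply g'
  have h1 : c' g' = Ψ (c (φ.symm g')) := by
    change c' g' = Ψ (Ψ' (c' (φ (φ.symm g'))))
    rw [hg']
    have h := adQuot_symm_adQuot (e := e.symm) (Ψ := Ψ') hΨ' (Ψ' := Ψ)
      (fun M => by rw [hΨ, RingEquiv.symm_symm]) (c' g')
    exact h.symm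
  rw [h1, hm, map_sub]
  change Ψ (adModScalar (Fin n) k ((φ.symm g' : H) : GL (Fin n) k) m) - Ψ m =
    adModScalar (Fin n) k' (g' : GL (Fin n) k') (Ψ m) - Ψ m
  rw [adQuot_adModScalar hΨ, ← hφ, hg']

/-- **Extended adequacy is invariant under an isomorphism of the coefficient field**:
`H ≤ GL_n(k)` adequate (GHT §1 / Thorne 2017 Def. 2.20) ⟹ `GL_n(e) H ≤ GL_n(k')` adequate. -/
theorem isExtendedAdequate_map (hH : Subgroup.IsExtendedAdequate H) :
    Subgroup.IsExtendedAdequate (H.map (Matrix.GeneralLinearGroup.map e.toRingHom)) :=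
  ⟨addMonoidHom_map_eq_zero e hH, cocycles₁_le_coboundaries₁_map e hH, semisimpleSpan_map_eq_top e hH⟩

end Transport

/-! ## 2. The Guralnick–Herzig–Tiep disjunction at universe `0` -/

/-- **GHT 2017 Thm 1.7 at level `0` from the named fact at levels `(u, v)`** (explicit-universe
form of `ght_univ_zero`).  For a finite group `G : Type`, a field `k : Type` of characteristic `p`
and a faithful absolutely irreducible `σ : G → GL_p(k)`: `σ(G)` is adequate in the extended sense,
or `G` has an abelian normal subgroup of index `p`, or `p = 3` and `#A₆ ≤ #G` (the counting shadow
of alternative (c), "the projective image is `PSL₂(9) ≅ A₆`"). -/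
theorem ght_univ_zero_aux (hGHT : ght2017_adequate_or_index_p_or_psl29.{u, v}) {p : ℕ} [Fact p.Prime]
    {k : Type} [Field k] [CharP k p] {G : Type} [Group G] [Finite G] (σ : G →* GL (Fin p) k)
    (hinj : Function.Injective σ) (hirr : IsAbsIrreducible σ) :
    Subgroup.IsExtendedAdequate σ.range ∨
      (∃ A : Subgroup G, A.Normal ∧ (∀ x ∈ A, ∀ y ∈ A, x * y = y * x) ∧ A.index = p) ∨
      (p = 3 ∧ Nat.card ↥(alternatingGroup (Fin 6)) ≤ Nat.card G) := by
  have hp : 0 < p := (Fact.out : p.Prime).pos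
  let e : ULift.{u} k ≃+* k := ULift.ringEquiv
  let uG : ULift.{v} G ≃* G := MulEquiv.ulift
  let σ' : ULift.{v} G →* GL (Fin p) (ULift.{u} k) :=
    (Matrix.GeneralLinearGroup.map e.symm.toRingHom).comp (σ.comp uG.toMonoidHom)
  have hσ' : ∀ g, Matrix.GeneralLinearGroup.map e.toRingHom (σ' g) = σ (uG g) := fun g =>
    glMap_glMap_symm e _
  have hinj' : Function.Injective σ' :=
    (glMap_injective e.symm).comp (hinj.comp uG.injective)
  have hirr' : IsAbsIrreducible σ' := by
    intro L _ f
    have hspan : Submodule.span k (Set.range fun g => ((σ g : GL (Fin p) k) : Matrix (Fin p) (Fin p) k)) = ⊤ :=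
      (span_eq_top_iff_forall_isIrreducible hp σ).2 hirr
    have hspanL := (span_range_map_eq_top_iff (f.comp e.symm.toRingHom) _).2 hspan
    refine isIrreducible_of_span_eq_top hp _ ?_
    have hset : (Set.range fun g' : ULift.{v} G =>
        (((Matrix.GeneralLinearGroup.map f).comp σ' g' : GL (Fin p) L) : Matrix (Fin p) (Fin p) L)) =
        Set.range fun g : G => ((σ g : GL (Fin p) k) : Matrix (Fin p) (Fin p) k).map (f.comp e.symm.toRingHom) := by
      ext M
      simp only [Set.mem_range]
      constructor
      · rintro ⟨g', rfl⟩
        exact ⟨uG g', by rw [RingHom.coe_comp, ← Matrix.map_map]; rfl⟩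
      · rintro ⟨g, rfl⟩
        refine ⟨uG.symm g, ?_⟩
        rw [RingHom.coe_comp, ← Matrix.map_map]
        change (((σ (uG (uG.symm g)) : GL (Fin p) k) : Matrix (Fin p) (Fin p) k).map e.symm).map f = _
        rw [MulEquiv.apply_symm_apply]
        rfl
    rw [hset]
    exact hspanL
  rcases hGHT p (ULift.{u} k) (ULift.{v} G) σ' hinj' hirr' with ha | ⟨A, hAn, hAc, hAi⟩ | ⟨hp3, ⟨ψ⟩⟩
  · left
    have hrange : σ.range = σ'.range.map (Matrix.GeneralLinearGroup.map e.toRingHom) := by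
      ext x
      constructor
      · rintro ⟨g, rfl⟩
        exact ⟨σ' (uG.symm g), ⟨uG.symm g, rfl⟩, by rw [hσ', MulEquiv.apply_symm_apply]⟩
      · rintro ⟨y, ⟨g', rfl⟩, rfl⟩
        exact ⟨uG g', (hσ' g').symm⟩
    rw [hrange]
    exact isExtendedAdequate_map e ha
  · right; left
    haveI := hAn
    refine ⟨A.comap uG.symm.toMonoidHom, inferInstance, fun x hx y hy => ?_, ?_⟩
    · have h := hAc _ hx _ hy
      have h' : uG.symm (x * y) = uG.symm (y * x) := by simpa [map_mul] using h
      exact uG.symm.injective h'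
    · rw [Subgroup.index_comap_of_surjective A uG.symm.surjective]
      exact hAi
  · right; right
    refine ⟨hp3, ?_⟩
    haveI : Finite ↥σ'.range := Finite.of_surjective _ (MonoidHom.rangeRestrict_surjective σ')
    calc Nat.card ↥(alternatingGroup (Fin 6))
        = Nat.card ↥(σ'.range.map (QuotientGroup.mk' (Subgroup.center (GL (Fin p) (ULift.{u} k))))) :=
          Nat.card_congr ψ.toEquiv.symm
      _ ≤ Nat.card ↥σ'.range := Nat.card_le_card_of_surjective _ (MonoidHom.subgroupMap_surjective _ _)
      _ ≤ Nat.card (ULift.{v} G) := Nat.card_le_card_of_surjective _ (MonoidHom.rangeRestrict_surjective σ')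
      _ = Nat.card G := Nat.card_congr uG.toEquiv

/-- **GHT 2017 Thm 1.7 at level `0`** (registered helper `ght_univ_zero` of the crux item): the named
fact `ght2017_adequate_or_index_p_or_psl29`, taken as a hypothesis at whatever universe levels the
statement is read at, implies its instance for `k G : Type`, with alternative (c) recorded through
the inequality `#A₆ ≤ #G`.  See `ght_univ_zero_aux`. -/
theorem ght_univ_zero : Literature.NumberTheory.GaloisRepresentations.ght2017_adequate_or_index_p_or_psl29 → ∀ {p : ℕ} [Fact p.Prime] {k : Type} [Field k] [CharP k p] {G : Type} [Group G] [Finite G] (σ : G →* GL (Fin p) k), Function.Injective σ → Literature.NumberTheory.GaloisRepresentations.IsAbsIrreducible σ → Literature.NumberTheory.GaloisRepresentations.Subgroup.IsExtendedAdequate σ.range ∨ (∃ A : Subgroup G, A.Normal ∧ (∀ x ∈ A, ∀ y ∈ A, x * y = y * x) ∧ A.index = p) ∨ (p = 3 ∧ Nat.card ↥(alternatingGroup (Fin 6)) ≤ Nat.card G) :=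
  fun hGHT _ _ _ _ _ _ _ _ σ hinj hirr => ght_univ_zero_aux hGHT σ hinj hirr

end

end Summit.Langlands.Langlands.Cruxes.MuOrdinaryFamilyRT.ThorneMinimalLift
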